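import Summits.CriticalPhenomena.PercolationContinuityZ3.Theorems.PercNearOneGluingNoHeavyLowerTailSahiCombPrincipalMeet

/-!
# `NoHeavyLowerTail` (crux stmt-CriticalPhenomena-4575), Sahi's `C₃`: INTERSECTION-PRESERVING ENLARGEMENT DECREASES `E₃` —
# a domination identity, its comb-level transfer, and a new stratum of (M⁺-3) / (★★)

Support file (cell `prim-l12`, seat P3, gen 2; `--supports stmt-CriticalPhenomena-4575`).  No `sorry`, no named facts, standard axioms.

**The identity** (`sahiE_three_domination`).  For events `U, A ⊆ A', B ⊆ B'` of a finite cube with `A' ∩ B' = A ∩ B` and ANY `p`: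

  `E₃(1_U,1_A,1_B) = E₃(1_U,1_{A'},1_{B'}) + (μA'−μA)·Cov(U,B') + (μB'−μB)·Cov(U,A') + (μA'−μA)(μB'−μB)·μU`
  `                 + μA·[μ(U∩B') − μ(U∩B)] + μB·[μ(U∩A') − μ(U∩A)]`

(pure algebra on the moments once `1_U 1_A 1_B = 1_U 1_{A'} 1_{B'}`).  For increasing `U, A', B'` every correction term is a product of
(M⁺-2)-covariances (`combPos_covFun`) and defect moments, so:
* **`combPos_sahiE_three_of_enlarge`** — COMB TRANSFER: `CombPos 3 (E₃(1_U,1_{A'},1_{B'})) → CombPos 3 (E₃(1_U,1_A,1_B))`;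
* **`sahiE_three_ind_ge_of_enlarge`** — MEASURE LEVEL: `E₃(μ_p; U,A,B) ≥ E₃(μ_p; U,A',B')` for all product measures: enlarging two
  increasing events while keeping their intersection can only DECREASE Sahi's functional (first slot fixed).  Hence the extremal pairs for
  Kahn's Conjecture 5 at fixed `U` and fixed `K = A ∩ B` are the CLOSED pairs (`A` the largest up-set with `A ∩ B = K`, and vice versa);
  and the junta transfer of `…SahiE3JuntaMeet` needs only its corner hypothesis (C3W) for the top pair `(A^D, B^D)` — taking
  `A' = A^D`, `B' = B^D` (remark; the dimension-free junta corollary needs a sub-cube transport and is not in this file).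
* NEW STRATUM (comb level, hence for (★★) by `ThreePartition.threePartNT_nonneg_of_combPos`): `combPos_sahiE_three_of_subset_cylinder` —
  if some cylinder `P ⊇ B` has `A ∩ P = A ∩ B` ("`B` completes to a cylinder without meeting `A` further"), then (M⁺-3) for `(U,A,B)`,
  every increasing `U` (enlarge `B` to `P`; cylinder-member stratum of `…SahiCombStrata`); `threePartNT_nonneg_of_subset_cylinder`.
Census (this seat, exact, `m = 4`, multiset triples of up-sets, HOME code/census_dom.py): of 804 440 triples, 766 581 lie on the five strata
of `…SahiCombStrata` or have an empty member, 5 604 more on the `P`-class (`…SahiCombPrincipalMeet`), and 11 943 more reduce to those by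
closing the pair opposite some slot; the remaining HARD CORE has 27 859 triples (3.5 %; at `m = 3` exactly one: `({a,b},{a,c},{b,c})`).
-/

noncomputable section

open scoped Classical

namespace Summit.CriticalPhenomena.PercolationContinuityZ3.Theorems

namespace SahiCombDomination

open Finset Function
open Literature.Combinatorics.Sahi2008
open Literature.Probability.Percolation.DecisionTree (ind ind_of_mem ind_of_not_mem ind_nonneg)
open SahiComb

variable {ι : Type} [Fintype ι]

/-- **The domination identity.**  For events `U, A ⊆ A', B ⊆ B'` with `A' ∩ B' = A ∩ B` (no monotonicity needed), under every weight `p`: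
`E₃(U,A,B) = E₃(U,A',B') + δ_A·Cov(U,B') + δ_B·Cov(U,A') + δ_A δ_B·μU + μA·[μ(U∩B')−μ(U∩B)] + μB·[μ(U∩A')−μ(U∩A)]`,
`δ_A = μA' − μA`, `δ_B = μB' − μB`. [this work] -/
theorem sahiE_three_domination (p : ι → unitInterval) {U A B A' B' : Set (Set ι)} (hK : A' ∩ B' = A ∩ B) :
    sahiE (bernoulliWeight p) 3 ![ind U, ind A, ind B] =
      sahiE (bernoulliWeight p) 3 ![ind U, ind A', ind B']
      + (ex (bernoulliWeight p) (ind A') - ex (bernoulliWeight p) (ind A)) * covFun U B' p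
      + (ex (bernoulliWeight p) (ind B') - ex (bernoulliWeight p) (ind B)) * covFun U A' p
      + (ex (bernoulliWeight p) (ind A') - ex (bernoulliWeight p) (ind A)) *
          (ex (bernoulliWeight p) (ind B') - ex (bernoulliWeight p) (ind B)) * ex (bernoulliWeight p) (ind U)
      + ex (bernoulliWeight p) (ind A) * (ex (bernoulliWeight p) (ind (U ∩ B')) - ex (bernoulliWeight p) (ind (U ∩ B)))
      + ex (bernoulliWeight p) (ind B) * (ex (bernoulliWeight p) (ind (U ∩ A')) - ex (bernoulliWeight p) (ind (U ∩ A))) := by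
  have hprod : ∀ X Y : Set (Set ι), ind X * ind Y = ind (X ∩ Y) := fun X Y => funext fun ω => SahiCombPrincipalMeet.ind_mul_apply X Y ω
  have h3 : ind U * ind A * ind B = ind U * ind A' * ind B' := by
    rw [mul_assoc, mul_assoc, hprod A B, hprod A' B', hK]
  rw [sahiE_three, sahiE_three, h3]
  simp only [hprod, covFun, hK]
  ring

/-- A defect moment `μ(Y) − μ(X)` for `X ⊆ Y` is comb-positive at multidegree `1`. [this work] -/
theorem combPos_ex_sub_of_subset {X Y : Set (Set ι)} (hXY : X ⊆ Y) :
    CombPos (fun _ : ι => 1) (fun p => ex (bernoulliWeight p) (ind Y) - ex (bernoulliWeight p) (ind X)) := by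
  have hle : ∀ ω, ind X ω ≤ ind Y ω := fun ω => by
    by_cases h0 : ω ∈ X
    · rw [ind_of_mem h0, ind_of_mem (hXY h0)]
    · rw [ind_of_not_mem h0]; exact ind_nonneg _ ω
  refine (combPos_ex (h := fun ω => ind Y ω - ind X ω) fun ω => sub_nonneg.2 (hle ω)).congr fun p => ?_
  simp only [ex_def, mul_sub, sum_sub_distrib]

/-- **Comb transfer along an intersection-preserving enlargement.**  For increasing `U, A', B'` and events `A ⊆ A'`, `B ⊆ B'` with
`A' ∩ B' = A ∩ B`: if `E₃(1_U,1_{A'},1_{B'})` is comb-positive then so is `E₃(1_U,1_A,1_B)`. [this work] -/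
theorem combPos_sahiE_three_of_enlarge {U A B A' B' : Set (Set ι)} (hU : IsUpperSet U) (hA' : IsUpperSet A') (hB' : IsUpperSet B')
    (hAA' : A ⊆ A') (hBB' : B ⊆ B') (hK : A' ∩ B' = A ∩ B)
    (h : CombPos (fun _ : ι => 3) (fun p => sahiE (bernoulliWeight p) 3 ![ind U, ind A', ind B'])) :
    CombPos (fun _ : ι => 3) (fun p => sahiE (bernoulliWeight p) 3 ![ind U, ind A, ind B]) := by
  have d11 : (fun _ : ι => (1 : ℕ)) + (fun _ : ι => 1) = fun _ : ι => 2 := by funext e; simp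
  have d12 : (fun _ : ι => (1 : ℕ)) + (fun _ : ι => 2) = fun _ : ι => 3 := by funext e; simp
  have d21 : (fun _ : ι => (2 : ℕ)) + (fun _ : ι => 1) = fun _ : ι => 3 := by funext e; simp
  have d23 : (fun _ : ι => (2 : ℕ)) ≤ (fun _ : ι => 3) := fun e => by norm_num
  have hdA := combPos_ex_sub_of_subset hAA'
  have hdB := combPos_ex_sub_of_subset hBB'
  have T1 : CombPos (fun _ : ι => 3)
      (fun p => (ex (bernoulliWeight p) (ind A') - ex (bernoulliWeight p) (ind A)) * covFun U B' p) :=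
    hdA.mul_of_eq (combPos_covFun U B' hU hB') d12
  have T2 : CombPos (fun _ : ι => 3)
      (fun p => (ex (bernoulliWeight p) (ind B') - ex (bernoulliWeight p) (ind B)) * covFun U A' p) :=
    hdB.mul_of_eq (combPos_covFun U A' hU hA') d12
  have T3 : CombPos (fun _ : ι => 3)
      (fun p => (ex (bernoulliWeight p) (ind A') - ex (bernoulliWeight p) (ind A)) *
        (ex (bernoulliWeight p) (ind B') - ex (bernoulliWeight p) (ind B)) * ex (bernoulliWeight p) (ind U)) :=
    (hdA.mul_of_eq hdB d11).mul_of_eq (combPos_ex_ind U) d21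
  have T4 : CombPos (fun _ : ι => 3)
      (fun p => ex (bernoulliWeight p) (ind A) *
        (ex (bernoulliWeight p) (ind (U ∩ B')) - ex (bernoulliWeight p) (ind (U ∩ B)))) :=
    ((combPos_ex_ind A).mul_of_eq (combPos_ex_sub_of_subset (Set.inter_subset_inter_right U hBB')) d11).mono d23
  have T5 : CombPos (fun _ : ι => 3)
      (fun p => ex (bernoulliWeight p) (ind B) *
        (ex (bernoulliWeight p) (ind (U ∩ A')) - ex (bernoulliWeight p) (ind (U ∩ A)))) :=
    ((combPos_ex_ind B).mul_of_eq (combPos_ex_sub_of_subset (Set.inter_subset_inter_right U hAA')) d11).mono d23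
  exact (((((h.add T1).add T2).add T3).add T4).add T5).congr fun p => sahiE_three_domination p hK

/-- **Measure level: intersection-preserving enlargement decreases `E₃`** under every product measure:
`E₃(μ_p; 1_U,1_A,1_B) ≥ E₃(μ_p; 1_U,1_{A'},1_{B'})` for increasing `U, A', B'`, `A ⊆ A'`, `B ⊆ B'`, `A' ∩ B' = A ∩ B`. [this work] -/
theorem sahiE_three_ind_ge_of_enlarge (p : ι → unitInterval) {U A B A' B' : Set (Set ι)} (hU : IsUpperSet U)
    (hA' : IsUpperSet A') (hB' : IsUpperSet B') (hAA' : A ⊆ A') (hBB' : B ⊆ B') (hK : A' ∩ B' = A ∩ B) :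
    sahiE (bernoulliWeight p) 3 ![ind U, ind A', ind B'] ≤ sahiE (bernoulliWeight p) 3 ![ind U, ind A, ind B] := by
  rw [sahiE_three_domination p hK]
  have hdA : 0 ≤ ex (bernoulliWeight p) (ind A') - ex (bernoulliWeight p) (ind A) := (combPos_ex_sub_of_subset hAA').nonneg p
  have hdB : 0 ≤ ex (bernoulliWeight p) (ind B') - ex (bernoulliWeight p) (ind B) := (combPos_ex_sub_of_subset hBB').nonneg p
  have hc1 : 0 ≤ covFun U B' p := (combPos_covFun U B' hU hB').nonneg p
  have hc2 : 0 ≤ covFun U A' p := (combPos_covFun U A' hU hA').nonneg p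
  have hu : 0 ≤ ex (bernoulliWeight p) (ind U) := (combPos_ex_ind U).nonneg p
  have ha : 0 ≤ ex (bernoulliWeight p) (ind A) := (combPos_ex_ind A).nonneg p
  have hb : 0 ≤ ex (bernoulliWeight p) (ind B) := (combPos_ex_ind B).nonneg p
  have hd4 : 0 ≤ ex (bernoulliWeight p) (ind (U ∩ B')) - ex (bernoulliWeight p) (ind (U ∩ B)) :=
    (combPos_ex_sub_of_subset (Set.inter_subset_inter_right U hBB')).nonneg p
  have hd5 : 0 ≤ ex (bernoulliWeight p) (ind (U ∩ A')) - ex (bernoulliWeight p) (ind (U ∩ A)) :=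
    (combPos_ex_sub_of_subset (Set.inter_subset_inter_right U hAA')).nonneg p
  have t1 := mul_nonneg hdA hc1
  have t2 := mul_nonneg hdB hc2
  have t3 := mul_nonneg (mul_nonneg hdA hdB) hu
  have t4 := mul_nonneg ha hd4
  have t5 := mul_nonneg hb hd5
  linarith

/-- **(★★) transfer**: if the enlarged triple `(U, A', B')` has comb-positive `E₃`, then `threePartNT τ U A B ≥ 0` for every twist.
[this work] -/
theorem threePartNT_nonneg_of_enlarge (τ : Set ι) {U A B A' B' : Set (Set ι)} (hU : IsUpperSet U) (hA' : IsUpperSet A')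
    (hB' : IsUpperSet B') (hAA' : A ⊆ A') (hBB' : B ⊆ B') (hK : A' ∩ B' = A ∩ B)
    (h : CombPos (fun _ : ι => 3) (fun p => sahiE (bernoulliWeight p) 3 ![ind U, ind A', ind B'])) :
    0 ≤ ThreePartition.threePartNT τ U A B :=
  ThreePartition.threePartNT_nonneg_of_combPos τ (combPos_sahiE_three_of_enlarge hU hA' hB' hAA' hBB' hK h)

/-! ### A new stratum: cylinder completion -/

/-- **Cylinder completion.**  If `U, A` are increasing and some cylinder `P = {a ⊆ ω} ⊇ B` satisfies `A ∩ P = A ∩ B` ("`B` completes to a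
cylinder without meeting `A` further"), then `E₃(1_U,1_A,1_B)` is comb-positive (enlarge `B` to `P`; cylinder-member stratum of
`…SahiCombStrata`). [this work] -/
theorem combPos_sahiE_three_of_subset_cylinder (a : Set ι) {U A B : Set (Set ι)} (hU : IsUpperSet U) (hA : IsUpperSet A)
    (hBP : B ⊆ {ω : Set ι | a ⊆ ω}) (hK : A ∩ {ω : Set ι | a ⊆ ω} = A ∩ B) :
    CombPos (fun _ : ι => 3) (fun p => sahiE (bernoulliWeight p) 3 ![ind U, ind A, ind B]) := by
  have hP : IsUpperSet {ω : Set ι | a ⊆ ω} := fun _ _ hle hω => Set.Subset.trans hω hle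
  refine combPos_sahiE_three_of_enlarge hU hA hP subset_rfl hBP hK ?_
  have hfam : (fun j => ind ((![U, A, {ω : Set ι | a ⊆ ω}] : Fin 3 → Set (Set ι)) j)) =
      ![ind U, ind A, ind {ω : Set ι | a ⊆ ω}] := by
    funext j; fin_cases j <;> rfl
  have h := combPos_sahiE_three_cylinder ![U, A, {ω : Set ι | a ⊆ ω}] (fun j => by fin_cases j <;> assumption) 2 a rfl
  rw [hfam] at h
  exact h

/-- The same at the level of twisted three-partition counts: `threePartNT τ U A B ≥ 0` for every twist. [this work] -/
theorem threePartNT_nonneg_of_subset_cylinder (τ : Set ι) (a : Set ι) {U A B : Set (Set ι)} (hU : IsUpperSet U)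
    (hA : IsUpperSet A) (hBP : B ⊆ {ω : Set ι | a ⊆ ω}) (hK : A ∩ {ω : Set ι | a ⊆ ω} = A ∩ B) :
    0 ≤ ThreePartition.threePartNT τ U A B :=
  ThreePartition.threePartNT_nonneg_of_combPos τ (combPos_sahiE_three_of_subset_cylinder a hU hA hBP hK)

/-- Law level: `E₃(μ_p; U, A, B) ≥ 0` under cylinder completion, every product measure. [this work] -/
theorem sahiE_three_ind_nonneg_of_subset_cylinder (p : ι → unitInterval) (a : Set ι) {U A B : Set (Set ι)} (hU : IsUpperSet U)
    (hA : IsUpperSet A) (hBP : B ⊆ {ω : Set ι | a ⊆ ω}) (hK : A ∩ {ω : Set ι | a ⊆ ω} = A ∩ B) :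
    0 ≤ sahiE (bernoulliWeight p) 3 ![ind U, ind A, ind B] :=
  (combPos_sahiE_three_of_subset_cylinder a hU hA hBP hK).nonneg p

end SahiCombDomination

end Summit.CriticalPhenomena.PercolationContinuityZ3.Theorems
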